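import Summits.PneNP.PneNP.Theses.RamseyUncertifiable
import Literature.Combinatorics.SimpleGraph.PaleySos
import Literature.Combinatorics.SimpleGraph.FKPseudomoments

/-!
# Line `weil-patch-transfer` for crux `PaleySosRung` (stmt-PneNP-9817) — lead's RESHAPED skeleton

Crux (route `RamseyUncertifiable` #4, `Summit.PneNP.PneNP.Theses.RamseyUncertifiable.PaleySosRung`):
`∀ t ≥ 1, ∃ η > 0, ∃ p₀, ∀ primes p ≥ p₀, p ≡ 1 (mod 4): p^η ≤ las⁽ᵗ⁾(P_p)`, `P_p = paleyGraph p`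
(`= SimpleGraph.fromRel fun x y : Fin p => IsSquare (x - y)`, `rfl`), `las⁽ᵗ⁾ = lasserreStableBound`.

Composition idea (unchanged from the planner's line card `Lines/weil-patch-transfer.md`): `las⁽ᵗ⁾`
is monotone under induced subgraphs (I), so ONE induced patch of `P_p` with a large Lasserre value
suffices; a uniformly random injective patch `x : Fin m ↪ Fin p` of size `m = ⌊p^{1/(2K+2)}⌋` has
every nonempty signed pattern of `≤ K` edges `C_K/√p ≤ m^{-K}`-biased by the one-variable Weil
bound (N); a deterministic SHELL turns pseudo-randomness of a graph on `Fin m` into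
`m^η ≤ las⁽ᵗ⁾`, and its pseudo-randomness hypotheses hold for two thirds of the patches (P)+(D).

## The reshape (lead, cycle 1): an elementary shell replaces MPW15

The planner's shell (S) was the deterministic core of Meka–Potechin–Wigderson 2015 (Johnson-scheme
eigenvalues §6–7 + §8 bookkeeping, XL). Because the crux tolerates ANY `η_t > 0`, a much cruder
certificate suffices, and its analysis is finite-dimensional algebra:

* Certificate: Feige–Krauthgamer moments `y_S = α_{|S|}·[S clique]` (tree `fkMoments`) with
  SUPER-EXPONENTIAL levels `α_k = κ_k α^k`, `κ_k = 2^{C(k,2)}·8^{k²}`, `α = m^{δ-1}`. By the Schur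
  complement of `y_∅ = 1` (F, the tree's `posSemidef_momentMatrix_fkMoments` one level up) it is
  enough that the level-`t` FILLED MATRIX `H[L,R] = α_{|L∪R|}·bip(L,R) − α_{|L|}α_{|R|}` (tree
  `bipInd`; nonempty `L, R` of size `≤ t`) is PSD.
* Constant part `C[L,R] = α_{|L∪R|}2^{-|L∖R||R∖L|} − α_{|L|}α_{|R|}`: expand `e = |L ∩ R| ↦ C` in the
  binomial basis `C(e,s) = #{T ⊆ L ∩ R : |T| = s}`; the kernel `Σ_{|T|=s} φ(|L|,|R|)[T ⊆ L][T ⊆ R]`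
  is PSD as soon as the small matrix `(φ(i,j))_{i,j}` is, and with `κ_k = 2^{C(k,2)}8^{k²}` the
  leading coefficient matrices are `D (8^{-(i-j)²})_{ij} D` — diagonally dominant — so
  `C ⪰ ⊕_i (α_i/4)·I_i` once `α ≤ α₀(t)` (checked in exact arithmetic, kit/stepA_check.py).
* Pattern part `P[L,R] = α_{|L∪R|}2^{-ab}σ(L,R)`, `σ = 2^{ab}bip − 1`, `a = |L∖R|`, `b = |R∖L|`:
  splitting by `T = L ∩ R` reduces every block to the rectangular MPW cross matrix
  `R_{a,b}[V,W] = [V ∩ W = ∅]·(2^{ab}·1[V × W ⊆ E] − 1)` on `a`-sets × `b`-sets, and block AM–GM shows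
  `|xᵀPx| ≤ ½ Σ_i (α_i/4)‖x_i‖²` provided `‖R_{a,b}‖ ≤ m^{(a+b)/2 − θ}` for ALL `1 ≤ a, b ≤ t` with a
  FIXED saving `θ > 0` (here `θ = 1/8`), at `α = m^{θ/(2t) − 1}`; value `m·α₁ = 8·m^{θ/(2t)}`.
* The saving on the patch: `‖R_{a,b}‖² ≤ max row sum of |R Rᵀ|`-type bounds (Schur test) after
  factoring `R_{a,b}` through the star matrices `T_k[V,W'] = Π_{w∈W'} τ(V,w)`,
  `τ(V,w) = 2^{|V|}·1[V ⊆ N(w)] − 1`; the entries of `T_kT_kᵀ` are elementary symmetric polynomials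
  of `w ↦ τ(V,w)τ(V',w)`, bounded by `max(|codeg(V,V')|, 4^a√m)^k`, where
  `codeg(V,V') = Σ_{w ∉ V∪V'} τ(V,w)τ(V',w)` concentrates at `(2^{|V∩V'|} − 1)(m − |V ∪ V'|) ± m^{1/2+γ}`
  for a `K`-wise `m^{-K}`-biased family (STAR patterns only: in the `2q`-th moment a non-vanishing
  configuration has every centre `w_l` repeated — the classical Füredi–Komlós count `≤ (2q)^{2q} m^q`).

So the registered stubs are now: (I) `stub_inducedMonotone` [S], (N) `stub_paleyPatternBias` [M]
(both verbatim from the planner's skeleton), (P) `stub_smallBiasCodegrees` [M/L],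
(D) `stub_crossNormOfCodegrees` [L], (F) `stub_filledReduction` [M], (S) `stub_filledShell` [L,
the lead's]. Every stub is stated over tree definitions only (`lasserreStableBound`, `paleyGraph`,
`bipInd`, `fkMoments`, `momentMatrix`) with all other objects inlined, so each lands as a pure
theorem file. The composition `PaleySosRung_of` is sorry-free outside the stubs.

## Disproof.lean (v6, cdisprove) obligations honoured

`paleySosRung_false_without_levelPos` — `1 ≤ t` enters (S) (the value exponent `1/(16t)`) and (I);
`_false_without_modFour`, `_false_without_prime` — both enter (N) only; `exponent_le_half` —
respected with room (`η_t/(4K+4) ≪ 1/2`); the refuted strengthenings (`√p` at all levels /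
eventually) are not approached; no `-- Targets`/Negative lemmas exist for this crux yet.
-/

set_option linter.dupNamespace false

namespace Summit.PneNP.PneNP.Cruxes.PaleySosRung.WeilPatchTransfer

open Literature.Combinatorics.SimpleGraph Finset Matrix
open Summit.PneNP.PneNP.Theses.RamseyUncertifiable

noncomputable section

/-- **(I) Induced-subgraph monotonicity of `las⁽ᵗ⁾`** (the transfer stub): for an embedding
`f : W ↪ V`, every Lasserre-feasible `y` of `G.comap f` extends by zero (`y' S = y (f⁻¹ S)` if
`S ⊆ range f`, else `0`) to a feasible vector of `G` with the same value, so
`las⁽ᵗ⁾(G.comap f) ≤ las⁽ᵗ⁾(G)`. Size S/M; leans on `IsLasserreFeasible`,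
`IsLasserreFeasible.sum_singleton_le_lasserreStableBound`, `lasserreStableBound_le_of_forall`,
`Matrix.PosSemidef.submatrix` (cf. the proved `lasserreStableBound_le_of_iso` in
`LasserreCliqueCover.lean`). [folklore; Laurent2006 §3.1] -/
theorem stub_inducedMonotone :
    ∀ {V W : Type*} [Fintype V] [DecidableEq V] [Fintype W] [DecidableEq W]
      (G : SimpleGraph V) (f : W ↪ V) {t : ℕ}, 1 ≤ t →
      lasserreStableBound (G.comap f) t ≤ lasserreStableBound G t := by
  sorry

/-- **(N) Weil small-bias of Paley patterns along random injective maps.** For every `k` there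
is `C ≥ 0` such that for every prime `p ≡ 1 (mod 4)`, every `m` and every NONEMPTY set `E` of at
most `k` ordered pairs `(a, b)`, `a < b`, of `Fin m`,
`|Σ_{x : Fin m ↪ Fin p} Π_{(a,b) ∈ E} sgn(x a ∼ x b)| ≤ C/√p · #(Fin m ↪ Fin p)`, where
`sgn = +1` on edges of `paleyGraph p` and `-1` otherwise (`= χ_p(x a - x b)` since `x a ≠ x b` and
`χ_p(-1) = 1`). Proof: the sum factors through the support `V` of `E` (`|V| ≤ 2k`); sum the vertex
`w` of maximal degree `d ≥ 1` last: `Σ_{z ∉ x(V∖w)} χ(Π_{j ∈ N(w)} (z - x_j))` is a complete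
character sum of a split squarefree polynomial (`≤ d√p`, tree `HybridLFunction.norm_hybridSum_le`
with `b = 0`) minus `≤ 2k` excluded points, whence bias `≤ (k√p + 2k)/(p - 2k + 1)`; small `p`
by the trivial bound. Size M. FALSE without `p % 4 = 1` (then `paleyGraph p = ⊤`, bias `1`) and
without primality — as `Disproof.lean` demands. [Weil1948; Schmidt1976 II.2C; arXiv:2211.02713 §7] -/
theorem stub_paleyPatternBias :
    ∀ k : ℕ, ∃ C : ℝ, 0 ≤ C ∧ ∀ p : ℕ, p.Prime → p % 4 = 1 → ∀ (m : ℕ)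
      [DecidableRel (paleyGraph p).Adj] (E : Finset (Fin m × Fin m)),
      E.Nonempty → E.card ≤ k → (∀ e ∈ E, e.1 < e.2) →
        |∑ x : (Fin m ↪ Fin p),
            ∏ e ∈ E, (if (paleyGraph p).Adj (x e.1) (x e.2) then (1 : ℝ) else -1)|
          ≤ C / Real.sqrt p * Fintype.card (Fin m ↪ Fin p) := by
  sorry

/-- **(P) Small bias ⇒ codegree concentration for two thirds of the samples** (probabilistic
stub, M/L). For `r` there are `k, m₀` such that for every finite family `H : ι → SimpleGraph (Fin m)`,
`m ≥ m₀`, which is `k`-wise `m^{-k}`-biased (every nonempty signed pattern of `≤ k` ordered edges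
averages to `≤ m^{-k}` in absolute value), outside an exceptional set `B` with `3|B| ≤ |ι|` every
`H i` satisfies: for all `1 ≤ a ≤ r` and all pairs of distinct `a`-sets `A, A'`, the STAR CODEGREE
`codeg(A,A') = Σ_{w ∉ A ∪ A'} τ(A,w)τ(A',w)`, `τ(A,w) = 2^{|A|}·1[A ⊆ N(w)] − 1`, is within `m^{9/16}`
of its `G(m,½)` mean `(2^{|A∩A'|} − 1)(m − |A ∪ A'|)`. Proof: `τ(A,w)τ(A',w) − (2^{|A∩A'|} − 1)` is a
signed combination (at most `4^a` terms) of star characters `χ_Q(w) = Π_{x∈Q} s(x,w)`, `∅ ≠ Q ⊆ A∪A'`;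
for `S_Q = Σ_{w ∉ A∪A'} χ_Q(w)` the `2q`-th moment `avg_i S_Q^{2q} = Σ_{w_1…w_{2q}} avg_i Π s` has
`avg = 1` when every centre `w_l` occurs an even number of times and `|avg| ≤ m^{-k}` otherwise
(`k ≥ 4qr`), so `avg_i S_Q^{2q} ≤ (2q)^{2q} m^q + m^{2q-k}`; Markov at `m^{1/2+1/32}` and a union bound
over the `≤ r·16^r·m^{2r}` tuples `(a, A, A', Q)` with `q = 32r + 16`. [Füredi–Komlós 1981;
arXiv:1503.06447 §9 (style)] -/
theorem stub_smallBiasCodegrees :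
    ∀ r : ℕ, ∃ k : ℕ, ∃ m₀ : ℕ, ∀ m ≥ m₀,
      ∀ (ι : Type*) [Fintype ι] (H : ι → SimpleGraph (Fin m)) [∀ i, DecidableRel (H i).Adj],
        (∀ E : Finset (Fin m × Fin m), E.Nonempty → E.card ≤ k → (∀ e ∈ E, e.1 < e.2) →
          |∑ i, ∏ e ∈ E, (if (H i).Adj e.1 e.2 then (1 : ℝ) else -1)|
            ≤ (Fintype.card ι : ℝ) / (m : ℝ) ^ k) →
        ∃ B : Finset ι, 3 * B.card ≤ Fintype.card ι ∧ ∀ i, i ∉ B →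
          ∀ a : ℕ, 1 ≤ a → a ≤ r → ∀ A A' : Finset (Fin m), A.card = a → A'.card = a → A ≠ A' →
            |(∑ w ∈ (Finset.univ \ (A ∪ A')),
                (if ∀ x ∈ A, (H i).Adj x w then (2 : ℝ) ^ a - 1 else -1) *
                (if ∀ x ∈ A', (H i).Adj x w then (2 : ℝ) ^ a - 1 else -1))
              - ((2 : ℝ) ^ (A ∩ A').card - 1) * ((m : ℝ) - ((A ∪ A').card : ℝ))|
              ≤ (m : ℝ) ^ ((9 : ℝ) / 16) := by
  sorry

/-- **(D) Codegree concentration ⇒ rectangular cross-matrix norm bounds with a saving**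
(deterministic stub, L). For `r` there is `m₀` such that every graph `G` on `Fin m`, `m ≥ m₀`, whose
star codegrees satisfy the conclusion of (P) (exponent `9/16`) has, for all `1 ≤ a, b ≤ r`, the
bilinear bound `|uᵀ R_{a,b} v| ≤ m^{(a+b)/2 − 1/8} ‖u‖ ‖v‖` for the rectangular MPW cross matrix
`R_{a,b}[V,W] = [V ∩ W = ∅]·(2^{ab}·1[V × W ⊆ E(G)] − 1)` on `a`-sets × `b`-sets (MPW15 (25)).
Proof: with `τ̂(V,w) = τ(V,w)` for `w ∉ V` and `−1` for `w ∈ V`,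
`R[V,W] = Π_{w∈W}(1 + τ̂(V,w)) − 1 + [V ∩ W ≠ ∅] = Σ_{k=1}^{b} Σ_{W' ⊆ W, |W'| = k} T_k[V,W'] + E[V,W]`,
`T_k[V,W'] = Π_{w ∈ W'} τ̂(V,w)`; `|uᵀEv| ≤ √(ab)·m^{(a+b)/2−1}‖u‖‖v‖`;
`|uᵀ T_k N_k v| ≤ ‖T_kᵀu‖·‖N_k v‖` with `‖N_k v‖² ≤ C(b,k) C(m-k,b-k) ‖v‖²` (Cauchy–Schwarz) and
`‖T_kᵀ u‖² ≤ ‖u‖²·max_V Σ_{V'} |(T_kT_kᵀ)[V,V']|` (Schur); `(T_kT_kᵀ)[V,V'] = e_k(w ↦ τ̂(V,w)τ̂(V',w))`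
and `|e_k(φ)| ≤ max(|Σ_w φ(w)|, 4^a√m)^k` (Newton: `k e_k = Σ_i (−1)^{i−1} e_{k−i} p_i`, `|p_i| ≤ 4^{ai} m`
for `i ≥ 2`); the hypothesis gives `|Σ_w φ| ≤ (2^c − 1)m + 2m^{9/16}` for `c = |V ∩ V'| ≥ 1`
(`≤ 2^a m^{a−1}` such `V'`) and `≤ 2m^{9/16}` for `c = 0`; so row sums are
`≤ C_r (m^{a+k−1} + m^{a+k(9/16)})`, whence `|uᵀT_kN_kv| ≤ C_r m^{(a+b)/2 − 7/32}‖u‖‖v‖`, and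
`7/32 > 1/8` absorbs `C_r` for `m ≥ m₀`. [arXiv:1503.06447 §8.2 (the matrices); folklore (Schur test)] -/
theorem stub_crossNormOfCodegrees :
    ∀ r : ℕ, ∃ m₀ : ℕ, ∀ m ≥ m₀, ∀ (G : SimpleGraph (Fin m)) [DecidableRel G.Adj],
      (∀ a : ℕ, 1 ≤ a → a ≤ r → ∀ A A' : Finset (Fin m), A.card = a → A'.card = a → A ≠ A' →
          |(∑ w ∈ (Finset.univ \ (A ∪ A')),
              (if ∀ x ∈ A, G.Adj x w then (2 : ℝ) ^ a - 1 else -1) *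
              (if ∀ x ∈ A', G.Adj x w then (2 : ℝ) ^ a - 1 else -1))
            - ((2 : ℝ) ^ (A ∩ A').card - 1) * ((m : ℝ) - ((A ∪ A').card : ℝ))|
            ≤ (m : ℝ) ^ ((9 : ℝ) / 16)) →
      ∀ a b : ℕ, 1 ≤ a → a ≤ r → 1 ≤ b → b ≤ r →
        ∀ (u : {S : Finset (Fin m) // S.card = a} → ℝ) (v : {S : Finset (Fin m) // S.card = b} → ℝ),
          |∑ A, ∑ B, u A * v B *
              (if Disjoint A.1 B.1 then
                (if ∀ x ∈ A.1, ∀ y ∈ B.1, G.Adj x y then (2 : ℝ) ^ (a * b) - 1 else -1)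
               else 0)|
            ≤ (m : ℝ) ^ (((a + b : ℕ) : ℝ) / 2 - 1 / 8) *
                Real.sqrt (∑ A, u A ^ 2) * Real.sqrt (∑ B, v B ^ 2) := by
  sorry

/-- **(F) The filled-matrix reduction at every level, for every finite graph** (M; the tree's
`posSemidef_momentMatrix_fkMoments` one level up). With `y = fkMoments G α`, `α₀ = 1`, and the
level-`t` filled matrix `H[L,R] = α_{|L∪R|}·bipInd G L R − α_{|L|}α_{|R|}` on NONEMPTY subsets of
size `≤ t`: `xᵀ M_t(y) x = (x_∅ + Σ_L y_L x_L)² + (d∘x)ᵀ H (d∘x)` with `d` the clique indicator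
(`fkMoments_union_sub_mul` holds for all `L, R`), so `H ⪰ 0 ⟹ M_t(y) ⪰ 0`. No hypothesis `1 ≤ t`.
[cite: KuniskyYu2022, §2.3, Prop. 3.3, Prop. 3.5] -/
theorem stub_filledReduction :
    ∀ (n t : ℕ) (G : SimpleGraph (Fin n)) [DecidableRel G.Adj] (α : ℕ → ℝ), α 0 = 1 →
      (Matrix.of fun L R : {S : Finset (Fin n) // 1 ≤ S.card ∧ S.card ≤ t} =>
          α (L.1 ∪ R.1).card * bipInd G L.1 R.1 - α L.1.card * α R.1.card).PosSemidef →
      (momentMatrix t (fkMoments G α)).PosSemidef := by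
  sorry

/-- **(S) The elementary filled-matrix shell (L, the lead's stub).** For every level `t ≥ 1`
there are `η > 0` and `m₀` such that every graph `G` on `Fin m`, `m ≥ m₀`, all of whose rectangular
MPW cross matrices `R_{a,b}` (`1 ≤ a, b ≤ t`, as in (D)) satisfy `|uᵀR_{a,b}v| ≤ m^{(a+b)/2−1/8}‖u‖‖v‖`
admits levels `α` with `α₀ = 1`, `m^η ≤ m·α₁` and a PSD level-`t` filled matrix. Proof (levels
`α_k = 2^{C(k,2)}8^{k²}α^k`, `α = m^{1/(16t) − 1}`, `η = 1/(16t)`): constant part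
`C ⪰ ⊕_i (α_i/4) I_i` by the binomial-basis expansion in `|L ∩ R|` (leading coefficient matrices
`D(8^{-(i-j)²})D`, diagonally dominant; lower-order terms `O_t(α)`); pattern part: split by
`T = L ∩ R` (`uᵀΣ^{(e)}_{ij}v = Σ_{|T|=e} ũ_TᵀR_{i−e,j−e}ṽ_T`, `Σ_T ‖ũ_T‖² = C(i,e)‖u‖²`), then
`α_{i+j−e}2^{-ab}·√(C(i,e)C(j,e))·m^{(a+b)/2−1/8} ≤ √(α_iα_j)/(8t(t+1))` because
`(αm)^{(a+b)/2} = m^{(a+b)/(32t)} ≤ m^{1/16}` and `m^{-1/16}` absorbs the constants for `m ≥ m₀`;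
AM–GM over the `≤ t²(t+1)` blocks gives `|xᵀPx| ≤ ½ Σ_i (α_i/4)‖x_i‖²`. [this line; HKP
arXiv:1507.05230 §4 (FK/MPW moments), Feige–Krauthgamer 2003] -/
theorem stub_filledShell :
    ∀ t : ℕ, 1 ≤ t → ∃ η : ℝ, 0 < η ∧ ∃ m₀ : ℕ, ∀ m ≥ m₀, ∀ (G : SimpleGraph (Fin m)) [DecidableRel G.Adj],
      (∀ a b : ℕ, 1 ≤ a → a ≤ t → 1 ≤ b → b ≤ t →
        ∀ (u : {S : Finset (Fin m) // S.card = a} → ℝ) (v : {S : Finset (Fin m) // S.card = b} → ℝ),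
          |∑ A, ∑ B, u A * v B *
              (if Disjoint A.1 B.1 then
                (if ∀ x ∈ A.1, ∀ y ∈ B.1, G.Adj x y then (2 : ℝ) ^ (a * b) - 1 else -1)
               else 0)|
            ≤ (m : ℝ) ^ (((a + b : ℕ) : ℝ) / 2 - 1 / 8) *
                Real.sqrt (∑ A, u A ^ 2) * Real.sqrt (∑ B, v B ^ 2)) →
      ∃ α : ℕ → ℝ, α 0 = 1 ∧ (m : ℝ) ^ η ≤ (m : ℝ) * α 1 ∧
        (Matrix.of fun L R : {S : Finset (Fin m) // 1 ≤ S.card ∧ S.card ≤ t} =>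
          α (L.1 ∪ R.1).card * bipInd G L.1 R.1 - α L.1.card * α R.1.card).PosSemidef := by
  sorry


/-! ### The composition: the six stubs imply the crux (kernel-checked, no `sorry` outside the stubs) -/

/-- **`PaleySosRung` from the six stubs.** Fix `t ≥ 1`; the shell (S) at level `t` yields an
exponent `η > 0` and a threshold; (D) and (P) at `r = t` yield a threshold, a pattern size `k` and
a threshold; put `K = k`, `L = 2K + 2` and let `C` be the Weil constant of (N) at `K`. For a prime
`p ≡ 1 (mod 4)`, `p ≥ p₀`, take the patch size `m = ⌊p^{1/L}⌋`, so that `C·m^K ≤ √p`, `m` exceeds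
every threshold, and `m ≥ p^{1/(2L)}`. The family of complemented patches `x ↦ (P_p.comap x)ᶜ`,
`x : Fin m ↪ Fin p`, is `K`-wise `m^{-K}`-biased by (N); by (P) at most a third of the samples
violate codegree concentration, so some patch `H` has it; (D) gives the cross-matrix bounds for `H`,
(S) gives levels `α` with a PSD filled matrix and `m^η ≤ m·α₁`, (F) makes the FK moments of `H`
Lasserre-feasible for `Hᶜ = P_p.comap x` with value `m·α₁`, and (I) transfers
`m^η ≤ las_t(P_p.comap x) ≤ las_t(P_p)`; finally `p^{η/(2L)} ≤ m^η`. -/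
theorem PaleySosRung_of : PaleySosRung := by
  intro t ht
  -- (S), (D), (P), (N): the parameters of the line at level `t`
  obtain ⟨η, hη, n₀, hS⟩ := stub_filledShell t ht
  obtain ⟨m₁, hD⟩ := stub_crossNormOfCodegrees t
  obtain ⟨K, m₂, hP⟩ := stub_smallBiasCodegrees t
  obtain ⟨C, hC0, hN⟩ := stub_paleyPatternBias K
  set L : ℕ := 2 * K + 2 with hL
  set M₀ : ℕ := max 1 (max n₀ (max m₁ m₂)) with hM₀
  set p₀ : ℕ := max (⌈C⌉₊ ^ L) (max ((M₀ + 1) ^ L) (4 ^ L)) with hp₀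
  have hLne : L ≠ 0 := by omega
  refine ⟨(L : ℝ)⁻¹ * ((1 / 2 : ℝ) * η), by positivity, p₀, fun p hp hprime h4 => ?_⟩
  -- basic facts about `p`
  have hp1 : (1 : ℝ) ≤ p := by exact_mod_cast hprime.one_lt.le
  have hp0 : (0 : ℝ) ≤ p := by positivity
  -- `ρ = p^{1/L}` and the patch size `m = ⌊ρ⌋`
  set ρ : ℝ := (p : ℝ) ^ ((L : ℝ)⁻¹) with hρ
  have hρ0 : 0 ≤ ρ := Real.rpow_nonneg hp0 _
  have hρL : ρ ^ L = (p : ℝ) := Real.rpow_inv_natCast_pow hp0 hLne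
  set m : ℕ := ⌊ρ⌋₊ with hm
  have hmρ : (m : ℝ) ≤ ρ := Nat.floor_le hρ0
  have hρm : ρ < m + 1 := Nat.lt_floor_add_one ρ
  -- `L`-th roots of the three lower bounds on `p`
  have root_le : ∀ x : ℝ, 0 ≤ x → x ^ L ≤ (p : ℝ) → x ≤ ρ := by
    intro x hx hxL
    rw [← hρL] at hxL
    exact (pow_le_pow_iff_left₀ hx hρ0 hLne).1 hxL
  have hCρ : C ≤ ρ := by
    refine (Nat.le_ceil C).trans (root_le _ (by positivity) ?_)
    exact_mod_cast (le_max_left _ _).trans hp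
  have hMρ : (M₀ : ℝ) + 1 ≤ ρ := by
    have h := root_le ((M₀ : ℝ) + 1) (by positivity)
      (by exact_mod_cast ((le_max_left _ _).trans (le_max_right _ _)).trans hp)
    exact h
  have h4ρ : (4 : ℝ) ≤ ρ :=
    root_le 4 (by norm_num) (by exact_mod_cast ((le_max_right _ _).trans (le_max_right _ _)).trans hp)
  -- `m` exceeds every threshold
  have hmM : M₀ ≤ m := by
    have h : (M₀ : ℝ) < (m : ℝ) + 1 := by linarith
    have h' : M₀ < m + 1 := by exact_mod_cast h
    omega
  have hm1 : 1 ≤ m := le_trans (le_max_left _ _) hmM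
  have hmn₀ : n₀ ≤ m := le_trans ((le_max_left _ _).trans (le_max_right _ _)) hmM
  have hmm₁ : m₁ ≤ m :=
    le_trans (((le_max_left _ _).trans (le_max_right _ _)).trans (le_max_right _ _)) hmM
  have hmm₂ : m₂ ≤ m :=
    le_trans (((le_max_right _ _).trans (le_max_right _ _)).trans (le_max_right _ _)) hmM
  have hm1R : (1 : ℝ) ≤ m := by exact_mod_cast hm1
  have hm0R : (0 : ℝ) < m := by linarith
  -- `m ≤ p`: the sample space `Fin m ↪ Fin p` is nonempty
  have hmp : m ≤ p := by
    have h : (m : ℝ) ≤ p := by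
      refine hmρ.trans ?_
      calc ρ = (p : ℝ) ^ ((L : ℝ)⁻¹) := rfl
        _ ≤ (p : ℝ) ^ (1 : ℝ) := by
            refine Real.rpow_le_rpow_of_exponent_le hp1 ?_
            exact inv_le_one_of_one_le₀ (by exact_mod_cast Nat.one_le_iff_ne_zero.2 hLne)
        _ = p := Real.rpow_one _
    exact_mod_cast h
  -- `C · m^K ≤ √p`: the Weil biases are below the small-bias threshold
  have hsqrt : Real.sqrt p = ρ ^ (K + 1) := by
    have hsq : ρ ^ (K + 1) * ρ ^ (K + 1) = (p : ℝ) := by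
      rw [← pow_add, show K + 1 + (K + 1) = L by omega, hρL]
    rw [← hsq, Real.sqrt_mul_self (pow_nonneg hρ0 _)]
  have hCm : C * (m : ℝ) ^ K ≤ Real.sqrt p := by
    rw [hsqrt, pow_succ']
    exact mul_le_mul hCρ (pow_le_pow_left₀ (Nat.cast_nonneg m) hmρ K) (by positivity) hρ0
  -- `p^{η/(2L)} ≤ m^η`
  have hfinal : (p : ℝ) ^ ((L : ℝ)⁻¹ * ((1 / 2 : ℝ) * η)) ≤ (m : ℝ) ^ η := by
    rw [Real.rpow_mul hp0, Real.rpow_mul hρ0, ← Real.sqrt_eq_rpow]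
    refine Real.rpow_le_rpow (Real.sqrt_nonneg _) ?_ hη.le
    -- `√ρ ≤ m` from `ρ < m + 1`, `ρ ≥ 4`
    have h2 : (2 : ℝ) ≤ Real.sqrt ρ := by
      rw [show (2 : ℝ) = Real.sqrt 4 by
        rw [show (4 : ℝ) = 2 ^ 2 by norm_num, Real.sqrt_sq (by norm_num)]]
      exact Real.sqrt_le_sqrt h4ρ
    have hsq : Real.sqrt ρ * Real.sqrt ρ = ρ := Real.mul_self_sqrt hρ0
    nlinarith
  -- the Paley graph, the sample space and the family of complemented patches
  set G₀ : SimpleGraph (Fin p) := paleyGraph p with hG₀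
  haveI instG : DecidableRel G₀.Adj := Classical.decRel _
  haveI : DecidableEq (Fin m ↪ Fin p) := Classical.decEq _
  have hcard : 0 < Fintype.card (Fin m ↪ Fin p) := by
    rw [Fintype.card_pos_iff]
    exact Function.Embedding.nonempty_of_card_le (by simpa using hmp)
  set H : (Fin m ↪ Fin p) → SimpleGraph (Fin m) := fun x => (G₀.comap x)ᶜ with hH
  -- (N) ⇒ the family is `K`-wise `m^{-K}`-biased (signs of `H x` are minus those of `G₀`)
  have hbias : ∀ E : Finset (Fin m × Fin m), E.Nonempty → E.card ≤ K →
      (∀ e ∈ E, e.1 < e.2) →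
      |∑ x : (Fin m ↪ Fin p), ∏ e ∈ E, (if (H x).Adj e.1 e.2 then (1 : ℝ) else -1)|
        ≤ (Fintype.card (Fin m ↪ Fin p) : ℝ) / (m : ℝ) ^ K := by
    intro E hE hEk hEo
    have hflip : ∀ x : (Fin m ↪ Fin p), ∏ e ∈ E, (if (H x).Adj e.1 e.2 then (1 : ℝ) else -1)
        = (-1) ^ E.card * ∏ e ∈ E, (if G₀.Adj (x e.1) (x e.2) then (1 : ℝ) else -1) := by
      intro x
      rw [← Finset.prod_neg]
      refine Finset.prod_congr rfl fun e he => ?_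
      have hne : e.1 ≠ e.2 := (hEo e he).ne
      have hadj : (H x).Adj e.1 e.2 ↔ ¬ G₀.Adj (x e.1) (x e.2) := by
        simp only [hH, SimpleGraph.compl_adj, SimpleGraph.comap_adj]
        exact ⟨fun h => h.2, fun h => ⟨hne, h⟩⟩
      by_cases h : G₀.Adj (x e.1) (x e.2)
      · rw [if_neg (fun h' => hadj.1 h' h), if_pos h]
      · rw [if_pos (hadj.2 h), if_neg h, neg_neg]
    rw [Finset.sum_congr rfl fun x _ => hflip x, ← Finset.mul_sum, abs_mul, abs_pow, abs_neg,
      abs_one, one_pow, one_mul]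
    have hW := hN p hprime h4 m E hE hEk hEo
    refine hW.trans ?_
    have hstep : C / Real.sqrt p ≤ 1 / (m : ℝ) ^ K := by
      rw [div_le_div_iff₀ (by positivity) (by positivity), one_mul]
      exact hCm
    calc C / Real.sqrt p * (Fintype.card (Fin m ↪ Fin p) : ℝ)
        ≤ 1 / (m : ℝ) ^ K * (Fintype.card (Fin m ↪ Fin p) : ℝ) :=
          mul_le_mul_of_nonneg_right hstep (Nat.cast_nonneg _)
      _ = (Fintype.card (Fin m ↪ Fin p) : ℝ) / (m : ℝ) ^ K := by
          rw [one_div, inv_mul_eq_div]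
  -- (P): all but at most a third of the samples have concentrated star codegrees
  obtain ⟨B, hB, hPB⟩ := hP m hmm₂ (Fin m ↪ Fin p) H hbias
  -- a good sample
  have hlt : B.card < (Finset.univ : Finset (Fin m ↪ Fin p)).card := by
    rw [Finset.card_univ]
    omega
  obtain ⟨x, -, hx⟩ := Finset.exists_mem_notMem_of_card_lt_card hlt
  -- (D): cross-matrix bounds for the good complemented patch; (S): the levels; (F): feasibility
  have hcross := hD m hmm₁ (H x) (hPB x hx)
  obtain ⟨α, hα0, hval, hpsd⟩ := hS m hmn₀ (H x) hcross
  have hM : (momentMatrix t (fkMoments (H x) α)).PosSemidef :=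
    stub_filledReduction m t (H x) α hα0 hpsd
  have hfeas : IsLasserreFeasible (H x)ᶜ t (fkMoments (H x) α) := by
    refine ⟨?_, ?_, hM⟩
    · rw [fkMoments_empty, hα0]
    · intro u v huv
      rw [SimpleGraph.compl_adj] at huv
      exact fkMoments_pair_of_not_adj _ α huv.1 huv.2
  have hlas := hfeas.sum_singleton_le_lasserreStableBound ht
  rw [sum_fkMoments_singleton, Fintype.card_fin] at hlas
  have hHc : (H x)ᶜ = G₀.comap x := compl_compl _
  rw [hHc] at hlas
  have hI := stub_inducedMonotone G₀ x ht
  rw [← paleyGraph_eq_fromRel]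
  exact hfinal.trans (hval.trans (hlas.trans hI))

end

end Summit.PneNP.PneNP.Cruxes.PaleySosRung.WeilPatchTransfer
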